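import Literature.Geometry.Lorentzian.KerrSchildHomogeneity
import HarnessLib

/-!
# `KerrShieldedSettles`, line `tapered-temporal-collar` — stub S6b `stub_kerrExteriorFlatDecay` (Aux)

Support file for crux `stmt-FinalStateConjecture-10054`
(`Summit.FinalStateConjecture.FinalStateConjecture.Theses.SwallowTheDatum.KerrShieldedSettles`), stub
`stub_kerrExteriorFlatDecay` (`C²` decay of the bent-flat-gauge deviation of Kerr–Schild Kerr from
`η`).  Beyond `8M` that deviation is the member `Ĝ(M, a, ·)` of an explicit family all of whose
ingredients (`H`, `ℓ`, `T′ = 2Mr/Δ`, `∇r`) are homogeneous of degree `0` under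
`(M, a, x) ↦ (λM, λa, λx)` (Kerr–Schild 1965, §2; Visser arXiv:0706.0622, (32)–(35)), and
`Ĝ(μ, α, ·) = μ • Q(μ, α, ·)` with `Q` jointly smooth in `(μ, α, y)` on `{r > 2|μ|}`.  To keep this a
pure proof file (no definitions, no notation) the family is carried by SECTION VARIABLES `S N D G Q`
constrained by their defining equations `hS hN hD hG hQ`; the stub file instantiates them by `rfl`.
Contents: `G = μ • Q`; homogeneity `G(εM, εa, εz) = G(M, a, z)` (with the degree-`0` homogeneity of
`∇r`, the registered helper stub `stub_kerrExteriorFlatDecayGradScaling`); stationarity; joint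
smoothness of `Q` (reusing `Kerr.contDiffAt_radius₂`, `Kerr.contDiffAt_ksPert₂`); the uniform bound
of `D^m Q(μ, κμ, ·)` on the compact unit shell `{|μ| ≤ 1/4, y⁰ = 0, r_{κμ}(y) = 1}`
(`Kerr.norm_iteratedFDeriv_slice_le`).

References: R. P. Kerr, A. Schild (1965), §2–§3 [KerrSchild1965]; M. Visser, arXiv:0706.0622,
(32)–(35) [arXiv07060622]; M. Dafermos, I. Rodnianski, arXiv:0811.0354, §5.1 [arXiv08110354].
-/

set_option linter.dupNamespace false

noncomputable section

open Set Filter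
open scoped Manifold ContDiff Topology
open Literature.Geometry.Lorentzian

namespace Summit.FinalStateConjecture.FinalStateConjecture.Theorems.SwallowTheDatum.KerrShieldedSettles

namespace KerrExteriorFlatDecay

/-- The Kerr–Schild perturbation is linear in the mass: `g_{μ,α} − η = μ (g_{1,α} − η)`.
[cite: arXiv07060622, (33)] -/
theorem ksPert_eq_mass_smul (μ α : ℝ) (y : E4) :
    Kerr.bilin μ α y - Minkowski.bilin = μ • (Kerr.bilin 1 α y - Minkowski.bilin) := by
  rw [Kerr.ksPert_eq, Kerr.ksPert_eq, Kerr.scalarH_eq_mul_scalarH_one μ, smul_smul]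
  congr 1
  ring

/-- `∇r` is homogeneous of degree `0`: `(∇ r_{εa})(εz) = (∇ r_a)(z)` (`ε > 0`), from
`r_{εa}(εz) = ε r_a(z)` (Visser arXiv:0706.0622, (35)). [cite: arXiv07060622, (35)] -/
theorem fderiv_radius_smul {ε : ℝ} (hε : 0 < ε) (a : ℝ) (z : E4) :
    fderiv ℝ (Kerr.radius (ε * a)) (ε • z) = fderiv ℝ (Kerr.radius a) z := by
  have h1 : (fun w ↦ Kerr.radius (ε * a) (ε • w)) = ε • Kerr.radius a := by
    funext w
    simp [Kerr.radius_smul hε]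
  have h2 := fderiv_comp_smul (f := Kerr.radius (ε * a)) (x := z) ε
  rw [h1] at h2
  haveI : Invertible ε := invertibleOfNonzero hε.ne'
  rw [fderiv_const_smul_of_invertible] at h2
  exact (smul_right_injective (E4 →L[ℝ] ℝ) hε.ne' h2).symm

/-- `∇r` is invariant under `t*`-translations. [cite: arXiv07060622, (35)] -/
theorem fderiv_radius_add_time (a : ℝ) (z : E4) (t : ℝ) :
    fderiv ℝ (Kerr.radius a) (z + t • E4.basisVector 0) = fderiv ℝ (Kerr.radius a) z := by
  have h := fderiv_comp_add_right (𝕜 := ℝ) (f := Kerr.radius a) (x := z) (t • E4.basisVector 0)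
  rw [show (fun x ↦ Kerr.radius a (x + t • E4.basisVector 0)) = Kerr.radius a from
    funext fun x ↦ Kerr.radius_add_time_smul_basisVector a x t] at h
  exact h.symm

/-- Where `r > 2|μ|` one has `Δ = r² − 2μr + α² > 0`. [folklore] -/
theorem delta_pos_of_lt {μ α r : ℝ} (h : 2 * |μ| < r) : 0 < r ^ 2 - 2 * μ * r + α ^ 2 := by
  have hr : 0 < r := lt_of_le_of_lt (by positivity) h
  nlinarith [mul_pos hr (sub_pos.2 h), le_abs_self μ, sq_nonneg α]

/-- `‖y⃗‖² − α² ≤ r²` (Visser arXiv:0706.0622, (35); the tree's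
`Kerr.spatialNorm_sq_sub_sq_le_radius_sq` of `KerrWaveEnergy.lean`, not imported here). [folklore] -/
theorem spatialNorm_sq_sub_sq_le (α : ℝ) (y : E4) :
    E4.spatialNorm y ^ 2 - α ^ 2 ≤ Kerr.radius α y ^ 2 := by
  -- adapted from Literature/Geometry/Lorentzian/KerrWaveEnergy.lean
  rw [Kerr.radius_sq]
  linarith [Kerr.abs_le_sqrt_radius_discr α y, le_abs_self (E4.spatialNorm y ^ 2 - α ^ 2)]

/-- `(B, f, g) ↦ B(f ·, g ·)` is smooth on the triple product (verbatim the tree's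
`Literature.Geometry.Kaehler.OsculatingUnitaryFrameProofs.contDiff_bilinearComp`, which is not
imported here). [folklore] -/
theorem contDiff_bilinearComp₃ {V : Type*} [NormedAddCommGroup V] [NormedSpace ℝ V]
    {n : WithTop ℕ∞} :
    ContDiff ℝ n fun p : (V →L[ℝ] V →L[ℝ] ℝ) × (V →L[ℝ] V) × (V →L[ℝ] V) ↦
      p.1.bilinearComp p.2.1 p.2.2 := by
  -- adapted from Literature/Geometry/Kaehler/OsculatingUnitaryFrameProofs.lean `contDiff_bilinearComp`
  have hflip : ContDiff ℝ n fun X : V →L[ℝ] V →L[ℝ] ℝ ↦ X.flip := by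
    refine IsBoundedLinearMap.contDiff
      { map_add := fun X Y ↦ ContinuousLinearMap.flip_add X Y
        map_smul := fun r X ↦ ContinuousLinearMap.flip_smul r X
        bound := ⟨1, one_pos, fun X ↦ ?_⟩ }
    rw [one_mul, ContinuousLinearMap.opNorm_flip]
  have hc : ContDiff ℝ n fun q : (V →L[ℝ] V →L[ℝ] ℝ) × (V →L[ℝ] V) ↦ q.1.comp q.2 :=
    (isBoundedBilinearMap_comp (𝕜 := ℝ) (E := V) (F := V) (G := V →L[ℝ] ℝ)).contDiff
  have h1 : ContDiff ℝ n fun p : (V →L[ℝ] V →L[ℝ] ℝ) × (V →L[ℝ] V) × (V →L[ℝ] V) ↦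
      (p.1.comp p.2.1).flip :=
    hflip.comp (hc.comp (contDiff_fst.prodMk (contDiff_fst.comp contDiff_snd)))
  exact hflip.comp (hc.comp (h1.prodMk (contDiff_snd.comp contDiff_snd)))

/-- Pointwise form: `x ↦ B(x)(f(x) ·, g(x) ·)` is `C^n` at `x` if `B`, `f`, `g` are. [folklore] -/
theorem contDiffAt_bilinearComp {V X : Type*} [NormedAddCommGroup V] [NormedSpace ℝ V]
    [NormedAddCommGroup X] [NormedSpace ℝ X] {n : WithTop ℕ∞} {B : X → V →L[ℝ] V →L[ℝ] ℝ}
    {f g : X → V →L[ℝ] V} {x : X} (hB : ContDiffAt ℝ n B x) (hf : ContDiffAt ℝ n f x)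
    (hg : ContDiffAt ℝ n g x) : ContDiffAt ℝ n (fun x ↦ (B x).bilinearComp (f x) (g x)) x :=
  ContDiffAt.comp
    (g := fun p : (V →L[ℝ] V →L[ℝ] ℝ) × (V →L[ℝ] V) × (V →L[ℝ] V) ↦ p.1.bilinearComp p.2.1 p.2.2)
    (f := fun x ↦ (B x, f x, g x)) x contDiff_bilinearComp₃.contDiffAt (hB.prodMk (hf.prodMk hg))

/-- `(μ, α, y) ↦ r_α(y)` is smooth where `r > 0` (`Kerr.contDiffAt_radius₂`). [cite: arXiv07060622, (35)] -/
theorem contDiffAt_radius₃ {q : ℝ × ℝ × E4} (hq : 0 < Kerr.radius q.2.1 q.2.2) :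
    ContDiffAt ℝ ∞ (fun q : ℝ × ℝ × E4 ↦ Kerr.radius q.2.1 q.2.2) q :=
  (Kerr.contDiffAt_radius₂ hq).comp q contDiffAt_snd

/-- `(μ, α, y) ↦ (∇ r_α)(y)` is smooth where `r > 0` (derivative in `y` of the jointly smooth
radius). [cite: arXiv07060622, (35)] -/
theorem contDiffAt_fderiv_radius₃ {q : ℝ × ℝ × E4} (hq : 0 < Kerr.radius q.2.1 q.2.2) :
    ContDiffAt ℝ ∞ (fun q : ℝ × ℝ × E4 ↦ fderiv ℝ (Kerr.radius q.2.1) q.2.2) q := by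
  have hmap : ContDiff ℝ ∞ (fun s : (ℝ × ℝ × E4) × E4 ↦ ((s.1.2.1, s.2) : ℝ × E4)) := by fun_prop
  have hf : ContDiffAt ℝ ∞ (fun s : (ℝ × ℝ × E4) × E4 ↦ Kerr.radius s.1.2.1 s.2) (q, q.2.2) :=
    ContDiffAt.comp (g := fun p : ℝ × E4 ↦ Kerr.radius p.1 p.2)
      (f := fun s : (ℝ × ℝ × E4) × E4 ↦ ((s.1.2.1, s.2) : ℝ × E4)) (q, q.2.2)
      (Kerr.contDiffAt_radius₂ hq) hmap.contDiffAt
  exact ContDiffAt.fderiv (f := fun (q : ℝ × ℝ × E4) (y : E4) ↦ Kerr.radius q.2.1 y)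
    (g := fun q : ℝ × ℝ × E4 ↦ q.2.2) hf contDiffAt_snd.snd (le_of_eq rfl)

/-- `(μ, α, y) ↦ H_{μ,α}(y) = μ H_{1,α}(y)` is smooth where `r > 0` (`Kerr.contDiffAt_scalarH₂`).
[cite: arXiv07060622, (33)] -/
theorem contDiffAt_scalarH₃ {q : ℝ × ℝ × E4} (hq : 0 < Kerr.radius q.2.1 q.2.2) :
    ContDiffAt ℝ ∞ (fun q : ℝ × ℝ × E4 ↦ Kerr.scalarH q.1 q.2.1 q.2.2) q := by
  have h1 : ContDiffAt ℝ ∞ (fun q : ℝ × ℝ × E4 ↦ Kerr.scalarH 1 q.2.1 q.2.2) q :=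
    (Kerr.contDiffAt_scalarH₂ 1 hq).comp q contDiffAt_snd
  have heq : (fun q : ℝ × ℝ × E4 ↦ Kerr.scalarH q.1 q.2.1 q.2.2) =
      fun q ↦ q.1 * Kerr.scalarH 1 q.2.1 q.2.2 :=
    funext fun q ↦ Kerr.scalarH_eq_mul_scalarH_one q.1 q.2.1 q.2.2
  rw [heq]
  exact contDiffAt_fst.mul h1

/-- `(μ, α, y) ↦ g_{μ,α}(y) = η + (2H ℓ) ⊗ ℓ` is smooth where `r > 0` (`Kerr.bilin_eq_fun`,
`Kerr.contDiffAt_nullCovector₂`). [cite: KerrSchild1965, §3] -/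
theorem contDiffAt_bilin₃ {q : ℝ × ℝ × E4} (hq : 0 < Kerr.radius q.2.1 q.2.2) :
    ContDiffAt ℝ ∞ (fun q : ℝ × ℝ × E4 ↦ Kerr.bilin q.1 q.2.1 q.2.2) q := by
  have hl : ContDiffAt ℝ ∞ (fun q : ℝ × ℝ × E4 ↦ Kerr.nullCovector q.2.1 q.2.2) q :=
    (Kerr.contDiffAt_nullCovector₂ hq).comp q contDiffAt_snd
  have hH := contDiffAt_scalarH₃ hq
  have heq : (fun q : ℝ × ℝ × E4 ↦ Kerr.bilin q.1 q.2.1 q.2.2) = fun q ↦ Minkowski.bilin +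
      E4.tmul ((2 * Kerr.scalarH q.1 q.2.1 q.2.2) • Kerr.nullCovector q.2.1 q.2.2)
        (Kerr.nullCovector q.2.1 q.2.2) := by
    funext q
    rw [Kerr.bilin_eq_fun]
  rw [heq]
  exact contDiffAt_const.add (((contDiffAt_const.mul hH).smul hl).smulRight hl)

/-! ### The comparison family: section variables constrained by their defining equations

* `S μ α y = 2r/(r² − 2μr + α²)` — the slope factor (`T′ = μ S` beyond `8μ`), degree `−1`;
* `N μ α y = S • dr ⊗ ∂₀ : E4 →L E4` — the unit bend (`d(T ∘ r) ⊗ ∂₀ = μ N` beyond `8μ`), degree `−1`;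
* `D μ α y = id + μ N` — the differential of the bent flat chart, degree `0`;
* `G μ α y = g_{μ,α}(y)(D ·, D ·) − η` — the comparison deviation `Ĝ`, degree `0`;
* `Q μ α y = g(N ·, D ·) + g(·, N ·) + (g_{1,α} − η)` — the reduced deviation, `Ĝ = μ • Q`, degree `−1`. -/

section Family

variable {S : ℝ → ℝ → E4 → ℝ}
  (hS : ∀ μ α y, S μ α y =
    2 * Kerr.radius α y / (Kerr.radius α y ^ 2 - 2 * μ * Kerr.radius α y + α ^ 2))
  {N : ℝ → ℝ → E4 → E4 →L[ℝ] E4}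
  (hN : ∀ μ α y, N μ α y = (S μ α y • fderiv ℝ (Kerr.radius α) y).smulRight (E4.basisVector 0))
  {D : ℝ → ℝ → E4 → E4 →L[ℝ] E4}
  (hD : ∀ μ α y, D μ α y = ContinuousLinearMap.id ℝ E4 + μ • N μ α y)
  {G : ℝ → ℝ → E4 → E4 →L[ℝ] E4 →L[ℝ] ℝ}
  (hG : ∀ μ α y, G μ α y = (Kerr.bilin μ α y).bilinearComp (D μ α y) (D μ α y) - Minkowski.bilin)
  {Q : ℝ → ℝ → E4 → E4 →L[ℝ] E4 →L[ℝ] ℝ}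
  (hQ : ∀ μ α y, Q μ α y = (Kerr.bilin μ α y).bilinearComp (N μ α y) (D μ α y) +
    (Kerr.bilin μ α y).bilinearComp (ContinuousLinearMap.id ℝ E4) (N μ α y) +
    (Kerr.bilin 1 α y - Minkowski.bilin))

include hD hG hQ in
/-- **`Ĝ = μ • Q`.** [cite: KerrSchild1965, §2] -/
theorem flatDev_eq_smul_redDev (μ α : ℝ) (y : E4) : G μ α y = μ • Q μ α y := by
  have hks := ksPert_eq_mass_smul μ α y
  rw [hG, hQ, hD]
  ext v w
  have hvw := congrArg (fun B : E4 →L[ℝ] E4 →L[ℝ] ℝ ↦ B v w) hks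
  simp only [sub_apply, smul_apply, smul_eq_mul] at hvw
  simp only [ContinuousLinearMap.bilinearComp_apply, sub_apply, add_apply, smul_apply,
    ContinuousLinearMap.id_apply, map_add, map_smul, smul_eq_mul]
  linear_combination hvw

include hS in
/-- The slope factor is homogeneous of degree `−1`. [cite: arXiv08110354, §5.1] -/
theorem slopeFactor_smul {ε : ℝ} (hε : 0 < ε) (M a : ℝ) (z : E4) :
    S (ε * M) (ε * a) (ε • z) = ε⁻¹ * S M a z := by
  rw [hS, hS, Kerr.radius_smul hε]
  set r := Kerr.radius a z
  have hε0 : ε ≠ 0 := hε.ne'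
  rw [show (ε * r) ^ 2 - 2 * (ε * M) * (ε * r) + (ε * a) ^ 2 =
      ε ^ 2 * (r ^ 2 - 2 * M * r + a ^ 2) by ring, show 2 * (ε * r) = ε * (2 * r) by ring,
    mul_div_mul_comm]
  congr 1
  field_simp

include hS hN in
/-- `μ N` is homogeneous of degree `0`. [cite: arXiv08110354, §5.1] -/
theorem smul_unitBend_smul {ε : ℝ} (hε : 0 < ε) (M a : ℝ) (z : E4) :
    (ε * M) • N (ε * M) (ε * a) (ε • z) = M • N M a z := by
  rw [hN, hN, slopeFactor_smul hS hε, fderiv_radius_smul hε]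
  ext v i
  simp only [smul_apply, ContinuousLinearMap.smulRight_apply, smul_eq_mul, smul_smul,
    PiLp.smul_apply]
  congr 1
  field_simp

include hS hN hD in
/-- `D` is homogeneous of degree `0`. [cite: arXiv08110354, §5.1] -/
theorem flatDiff_smul {ε : ℝ} (hε : 0 < ε) (M a : ℝ) (z : E4) :
    D (ε * M) (ε * a) (ε • z) = D M a z := by
  rw [hD, hD, smul_unitBend_smul hS hN hε]

include hS hN hD hG in
/-- **`Ĝ` is homogeneous of degree `0`**: `Ĝ(εM, εa, εz) = Ĝ(M, a, z)` for `ε > 0`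
(`g_{εM,εa}(εz) = g_{M,a}(z)`, `Kerr.bilin_dilate`). [cite: KerrSchild1965, §2] -/
theorem flatDev_smul {ε : ℝ} (hε : 0 < ε) (M a : ℝ) (z : E4) :
    G (ε * M) (ε * a) (ε • z) = G M a z := by
  rw [hG, hG, flatDiff_smul hS hN hD hε, Kerr.bilin_dilate hε]

include hS hN hD hG hQ in
/-- The scaling law in the form used by the stub: `Ĝ(M, a, ·) = (εM) • Q(εM, εa, ·) ∘ (ε ·)` for
`ε > 0`. [cite: KerrSchild1965, §2] -/
theorem flatDev_eq_smul_redDev_comp_smul {ε : ℝ} (hε : 0 < ε) (M a : ℝ) :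
    G M a = fun z ↦ (ε * M) • Q (ε * M) (ε * a) (ε • z) := by
  funext z
  rw [← flatDev_eq_smul_redDev hD hG hQ, flatDev_smul hS hN hD hG hε]

include hS hN hD hG in
/-- `Ĝ(M, a, z + t ∂₀) = Ĝ(M, a, z)`. [cite: KerrSchild1965, §2] -/
theorem flatDev_add_time (M a : ℝ) (z : E4) (t : ℝ) :
    G M a (z + t • E4.basisVector 0) = G M a z := by
  simp only [hG, hD, hN, hS, Kerr.radius_add_time_smul_basisVector, fderiv_radius_add_time,
    Kerr.bilin_add_smul_basisVector_zero]

include hS hN hD hG in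
/-- Hence `D^m Ĝ(M, a, ·)` takes the same value at `z` and at `z + t ∂₀`. [cite: KerrSchild1965, §2] -/
theorem iteratedFDeriv_flatDev_add_time (M a : ℝ) (m : ℕ) (z : E4) (t : ℝ) :
    iteratedFDeriv ℝ m (G M a) (z + t • E4.basisVector 0) = iteratedFDeriv ℝ m (G M a) z := by
  have key := iteratedFDeriv_comp_add_right (𝕜 := ℝ) (E := E4) (F := E4 →L[ℝ] E4 →L[ℝ] ℝ)
    (f := G M a) m (t • E4.basisVector 0) z
  rw [show (fun x ↦ G M a (x + t • E4.basisVector 0)) = G M a from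
    funext fun x ↦ flatDev_add_time hS hN hD hG M a x t] at key
  exact key.symm

include hS in
/-- `(μ, α, y) ↦ S(μ, α, y)` is smooth where `r > 2|μ|`. [cite: arXiv08110354, §5.1] -/
theorem contDiffAt_slopeFactor₃ {q : ℝ × ℝ × E4} (hq : 2 * |q.1| < Kerr.radius q.2.1 q.2.2) :
    ContDiffAt ℝ ∞ (fun q : ℝ × ℝ × E4 ↦ S q.1 q.2.1 q.2.2) q := by
  have hq0 : 0 < Kerr.radius q.2.1 q.2.2 := lt_of_le_of_lt (by positivity) hq
  have hr := contDiffAt_radius₃ hq0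
  rw [show (fun q : ℝ × ℝ × E4 ↦ S q.1 q.2.1 q.2.2) = fun q ↦ 2 * Kerr.radius q.2.1 q.2.2 /
      (Kerr.radius q.2.1 q.2.2 ^ 2 - 2 * q.1 * Kerr.radius q.2.1 q.2.2 + q.2.1 ^ 2) from
    funext fun q ↦ hS _ _ _]
  exact (contDiffAt_const.mul hr).div (((hr.pow 2).sub ((contDiffAt_const.mul contDiffAt_fst).mul
    hr)).add (contDiffAt_snd.fst.pow 2)) (delta_pos_of_lt hq).ne'

include hS hN in
/-- `(μ, α, y) ↦ N(μ, α, y)` is smooth where `r > 2|μ|`. [cite: arXiv08110354, §5.1] -/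
theorem contDiffAt_unitBend₃ {q : ℝ × ℝ × E4} (hq : 2 * |q.1| < Kerr.radius q.2.1 q.2.2) :
    ContDiffAt ℝ ∞ (fun q : ℝ × ℝ × E4 ↦ N q.1 q.2.1 q.2.2) q := by
  have hq0 : 0 < Kerr.radius q.2.1 q.2.2 := lt_of_le_of_lt (by positivity) hq
  rw [show (fun q : ℝ × ℝ × E4 ↦ N q.1 q.2.1 q.2.2) = fun q ↦
      (S q.1 q.2.1 q.2.2 • fderiv ℝ (Kerr.radius q.2.1) q.2.2).smulRight (E4.basisVector 0) from
    funext fun q ↦ hN _ _ _]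
  exact ((contDiffAt_slopeFactor₃ hS hq).smul (contDiffAt_fderiv_radius₃ hq0)).smulRight
    contDiffAt_const

include hS hN hD in
/-- `(μ, α, y) ↦ D(μ, α, y)` is smooth where `r > 2|μ|`. [cite: arXiv08110354, §5.1] -/
theorem contDiffAt_flatDiff₃ {q : ℝ × ℝ × E4} (hq : 2 * |q.1| < Kerr.radius q.2.1 q.2.2) :
    ContDiffAt ℝ ∞ (fun q : ℝ × ℝ × E4 ↦ D q.1 q.2.1 q.2.2) q := by
  rw [show (fun q : ℝ × ℝ × E4 ↦ D q.1 q.2.1 q.2.2) = fun q ↦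
      ContinuousLinearMap.id ℝ E4 + q.1 • N q.1 q.2.1 q.2.2 from funext fun q ↦ hD _ _ _]
  exact contDiffAt_const.add (contDiffAt_fst.smul (contDiffAt_unitBend₃ hS hN hq))

include hS hN hD hQ in
/-- **`Q` is jointly smooth in `(μ, α, y)` where `r > 2|μ|`.** [cite: KerrSchild1965, §3] -/
theorem contDiffAt_redDev₃ {q : ℝ × ℝ × E4} (hq : 2 * |q.1| < Kerr.radius q.2.1 q.2.2) :
    ContDiffAt ℝ ∞ (fun q : ℝ × ℝ × E4 ↦ Q q.1 q.2.1 q.2.2) q := by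
  have hq0 : 0 < Kerr.radius q.2.1 q.2.2 := lt_of_le_of_lt (by positivity) hq
  have hb := contDiffAt_bilin₃ hq0
  have hN' := contDiffAt_unitBend₃ hS hN hq
  have hD' := contDiffAt_flatDiff₃ hS hN hD hq
  have hks : ContDiffAt ℝ ∞ (fun q : ℝ × ℝ × E4 ↦ Kerr.bilin 1 q.2.1 q.2.2 - Minkowski.bilin) q :=
    (Kerr.contDiffAt_ksPert₂ hq0).comp q contDiffAt_snd
  rw [show (fun q : ℝ × ℝ × E4 ↦ Q q.1 q.2.1 q.2.2) = fun q ↦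
      (Kerr.bilin q.1 q.2.1 q.2.2).bilinearComp (N q.1 q.2.1 q.2.2) (D q.1 q.2.1 q.2.2) +
      (Kerr.bilin q.1 q.2.1 q.2.2).bilinearComp (ContinuousLinearMap.id ℝ E4) (N q.1 q.2.1 q.2.2) +
      (Kerr.bilin 1 q.2.1 q.2.2 - Minkowski.bilin) from funext fun q ↦ hQ _ _ _]
  exact ((contDiffAt_bilinearComp hb hN' hD').add
    (contDiffAt_bilinearComp hb contDiffAt_const hN')).add hks

include hS hN hD hQ in
/-- The slice `Q(μ, α, ·)` is smooth at `y` where `r_α(y) > 2|μ|`. [cite: KerrSchild1965, §3] -/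
theorem contDiffAt_redDev {μ α : ℝ} {y : E4} (h : 2 * |μ| < Kerr.radius α y) {n : WithTop ℕ∞}
    (hn : n ≤ ∞) : ContDiffAt ℝ n (Q μ α) y := by
  have hmap : ContDiff ℝ ∞ (fun y : E4 ↦ ((μ, α, y) : ℝ × ℝ × E4)) := by fun_prop
  exact ((contDiffAt_redDev₃ hS hN hD hQ (q := (μ, α, y)) h).comp y hmap.contDiffAt).of_le hn

include hS hN hD hQ in
/-- The one-parameter family `(μ, y) ↦ Q(μ, κμ, y)` is smooth where `r_{κμ}(y) > 2|μ|`.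
[cite: KerrSchild1965, §3] -/
theorem contDiffAt_redDev_family (κ : ℝ) {p : ℝ × E4}
    (hp : 2 * |p.1| < Kerr.radius (κ * p.1) p.2) :
    ContDiffAt ℝ ∞ (fun p : ℝ × E4 ↦ Q p.1 (κ * p.1) p.2) p := by
  have hmap : ContDiff ℝ ∞ (fun p : ℝ × E4 ↦ ((p.1, κ * p.1, p.2) : ℝ × ℝ × E4)) := by fun_prop
  exact (contDiffAt_redDev₃ hS hN hD hQ (q := (p.1, κ * p.1, p.2)) hp).comp p hmap.contDiffAt

include hS hN hD hQ in
/-- **Uniform bound on the unit shell.** For `|κ| ≤ 1` and every order `m` there is `B` with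
`‖D^m Q(μ, κμ, ·)(y)‖ ≤ B` whenever `|μ| ≤ 1/4`, `y⁰ = 0`, `r_{κμ}(y) = 1` (continuity of `D^m` of
the jointly smooth family on a compact subset of `{r > 2|μ|}`). [cite: KerrSchild1965, §3] -/
theorem exists_bound_iteratedFDeriv_redDev {κ : ℝ} (hκ : |κ| ≤ 1) (m : ℕ) :
    ∃ B : ℝ, ∀ μ : ℝ, |μ| ≤ 1 / 4 → ∀ y : E4, y 0 = 0 → Kerr.radius (κ * μ) y = 1 →
      ‖iteratedFDeriv ℝ m (Q μ (κ * μ)) y‖ ≤ B := by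
  set g : ℝ × E4 → E4 →L[ℝ] E4 →L[ℝ] ℝ := fun p ↦ Q p.1 (κ * p.1) p.2 with hg
  set O : Set (ℝ × E4) := {p | 2 * |p.1| < Kerr.radius (κ * p.1) p.2} with hO
  have hrc : Continuous fun p : ℝ × E4 ↦ Kerr.radius (κ * p.1) p.2 := by
    unfold Kerr.radius E4.spatialNorm
    fun_prop
  have hOo : IsOpen O :=
    isOpen_lt (continuous_const.mul (continuous_abs.comp continuous_fst)) hrc
  have hcd : ContDiffOn ℝ ∞ g O :=
    fun p hp ↦ (contDiffAt_redDev_family hS hN hD hQ κ hp).contDiffWithinAt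
  have hcont : ContinuousOn (iteratedFDeriv ℝ m g) O := by
    have h1 := hcd.continuousOn_iteratedFDerivWithin (m := m) (by exact_mod_cast le_top)
      hOo.uniqueDiffOn
    exact h1.congr fun p hp ↦ (iteratedFDerivWithin_of_isOpen m hOo hp).symm
  set K : Set (ℝ × E4) :=
    {p | |p.1| ≤ 1 / 4 ∧ p.2 0 = 0 ∧ Kerr.radius (κ * p.1) p.2 = 1} with hK
  have hKc : IsCompact K := by
    have hclosed : IsClosed K := by
      have h1 : IsClosed {p : ℝ × E4 | |p.1| ≤ 1 / 4} :=
        isClosed_le (continuous_abs.comp continuous_fst) continuous_const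
      have h2 : IsClosed {p : ℝ × E4 | p.2 0 = 0} :=
        isClosed_eq ((PiLp.continuous_apply 2 _ 0).comp continuous_snd) continuous_const
      have h3 : IsClosed {p : ℝ × E4 | Kerr.radius (κ * p.1) p.2 = 1} := isClosed_eq hrc continuous_const
      exact h1.inter (h2.inter h3)
    refine Metric.isCompact_of_isClosed_isBounded hclosed ?_
    refine (Metric.isBounded_closedBall (x := (0 : ℝ × E4)) (r := 2)).subset ?_
    rintro ⟨μ, y⟩ ⟨hμ, hy0, hr⟩
    rw [Metric.mem_closedBall, dist_zero_right, Prod.norm_def]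
    refine max_le ?_ ?_
    · change |μ| ≤ 2
      linarith
    · change ‖y‖ ≤ 2
      have hα : (κ * μ) ^ 2 ≤ 1 := by
        rw [mul_pow, ← one_mul (1 : ℝ)]
        have h1 : κ ^ 2 ≤ 1 := by nlinarith [abs_nonneg κ, sq_abs κ]
        have h2 : μ ^ 2 ≤ 1 := by nlinarith [abs_nonneg μ, sq_abs μ]
        exact mul_le_mul h1 h2 (sq_nonneg μ) zero_le_one
      have hs := spatialNorm_sq_sub_sq_le (κ * μ) y
      rw [hr] at hs
      have hsq : ‖y‖ ^ 2 ≤ 4 := by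
        have h' := E4.spatialNorm_sq y
        rw [EuclideanSpace.real_norm_sq_eq, Fin.sum_univ_four, hy0]
        nlinarith [h']
      nlinarith [norm_nonneg y]
  have hKO : K ⊆ O := by
    rintro ⟨μ, y⟩ ⟨hμ, -, hr⟩
    change 2 * |μ| < Kerr.radius (κ * μ) y
    rw [hr]
    linarith
  obtain ⟨C, hC⟩ := hKc.exists_bound_of_continuousOn (hcont.mono hKO)
  refine ⟨C, fun μ hμ y hy0 hy1 ↦ ?_⟩
  have hmem : (μ, y) ∈ K := ⟨hμ, hy0, hy1⟩
  have hslice := Kerr.norm_iteratedFDeriv_slice_le hOo hcd (hKO hmem) (i := m)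
    (by exact_mod_cast le_top)
  exact hslice.trans (hC _ hmem)

end Family

end KerrExteriorFlatDecay

/-- **Registered helper stub `stub_kerrExteriorFlatDecayGradScaling`** (Aux module of S6b
`stub_kerrExteriorFlatDecay`): the Kerr–Schild radial gradient is homogeneous of degree `0`,
`(∇ r_{εa})(εz) = (∇ r_a)(z)` for `ε > 0` — the homogeneity input of the scaling proof (Visser
arXiv:0706.0622, (35): `r_{εa}(εz) = ε r_a(z)`). [cite: arXiv07060622, (35)] -/
theorem stub_kerrExteriorFlatDecayGradScaling : ∀ (ε a : ℝ) (z : E4), 0 < ε →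
    fderiv ℝ (Kerr.radius (ε * a)) (ε • z) = fderiv ℝ (Kerr.radius a) z :=
  fun _ a z hε ↦ KerrExteriorFlatDecay.fderiv_radius_smul hε a z

end Summit.FinalStateConjecture.FinalStateConjecture.Theorems.SwallowTheDatum.KerrShieldedSettles

end
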